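import Summits.QuantumFields.QCD.Theorems.ChiralDescent.Negative.DataLevelObstruction
import Summits.QuantumFields.QCD.Theorems.RobustYangMillsHandover.Negative.SchemeAsymptotics

/-!
# Line `gap-upset-recut` for `ChiralDescent` (crux stmt-QuantumFields-17527) — the wall no-go W reduced to the
# FULL-SEQUENCE wall `m_crit(k) → −1` (lead c11, cycle 1; helper `--supports` stmt-QuantumFields-17527)

The registered corner stub `stub_wallNoGo` (W) of `Cruxes/ChiralDescent/Lines/gap_upset_recut.lean` denies the threshold
body above every offset `μ` for a mass-scaling regularisation whose critical masses dip FREQUENTLY below every `c > −1`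
(`lim inf_k m_crit(k) ≤ −1`).  This file isolates, kernel-checked, how much of W is bookkeeping and what its exact residue is:

* `eventually_lt_mcrit_of_isQCDAlong` — the branch clause of `IsQCDAlong` at ONE tuple plus mass scaling
  (`a_k m_f / Z_m(k) → 0`) force `m_crit(k) > c` eventually for every `c < −1`: a regularisation carrying the body at a
  single tuple has `lim inf m_crit ≥ −1`.  So "beyond the wall" W is free (the concurrent lead a1's registered `wallNoGo_of_beyondWall`), and under W's
  hypothesis the body pins `lim inf m_crit = −1` exactly.
* `exists_strictMono_tendsto_wall` — from `lim inf = −1` (the two one-sided eventual/frequent bounds) a strictly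
  increasing `φ` with `m_crit ∘ φ → −1` (`Filter.extraction_forall_of_frequently`).
* `bodyAbove_restrict` — the body above an offset is HEREDITARY to every subsequence `reg.restrict φ` (the three clauses
  of `IsQCDAlong` and the lattice gap are `Tendsto`/`∀ᶠ` statements in `k` reading only the step-`k` data; the species
  renormalisations are reindexed with `φ`; the OS data and their gap are unchanged).
* `wallNoGo_iff_wallLimitNoGo` — HENCE W IS EQUIVALENT TO ITS FULL-SEQUENCE FORM
  `W_lim : ∀ N_f ∈ {2,3}, ∀ reg mass-scaling, m_crit(k) → −1 (k → ∞) ⇒ no offset carries the body`: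
  lattice QCD with ALL bare quark masses of every fixed renormalised tuple tending to `−1⁺` (hopping parameter `→ 1/6⁻`)
  along an asymptotically scaling trajectory has no OS limit with non-trivial flavour-changing pseudoscalars and both gaps.
  This is the statement a planner should register / promote in place of W (no `lim inf`, no offsets hidden in a
  subsequence), and the statement the disprover should attack.

SIZING NOTE for the planner (not formalised): `W_lim` is NOT inside hopping-expansion technology.  The Wilson hopping
term is a sum of `2d = 8` operators `½[(1 − γ_μ) U_μ T_μ + (1 + γ_μ) U_μ† T_μ⁻¹]`, each UNITARY for every gauge field, so
`D_W = (m₀ + 4) − H` with `‖H‖ ≤ 4` sharp (free field at `p = 0`): the Neumann/hopping series converges uniformly in `U`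
exactly for `m₀ > 0` (`κ < 1/8`), and `m₀ → −1` is outside every such bound.  For the FREE field at `m₀ = −1` one still has
`|D(p)|² = 1 + 2 Σ_{μ<ν} (1 − cos p_μ)(1 − cos p_ν) ≥ 1` (all species at cutoff mass — the perturbative picture behind W),
but for general gauge fields the supercritical Wilson operator `D_W(U; m₀)`, `−2 < m₀ < 0`, has real-mode crossings and
near-zero modes; the expected mechanism for decoupling there is LOCALISATION of those modes (Golterman–Shamir 2003,
Golterman–Shamir–Svetitsky 2005: mobility edge), numerically supported and unproved.  W is therefore of the same
open-problem grade as the other three stubs, not "M–L"; see the lead's folder `inputs/W-wall-sizing.md`.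

Pure bookkeeping over `QCDOS.lean`; standard axioms; no physics is proved here.
-/

namespace Summit.QuantumFields.QCD.Cruxes.ChiralDescent.GapUpsetRecut.WallLimit

open Filter Topology
open Literature.MathematicalPhysics.QuantumFieldTheory
open Summit.QuantumFields.QCD.Theorems.RobustYangMillsHandover.Negative (tendsto_massIncrement_zero)

variable {Nf : ℕ}

/-! ## §1 The body pins `lim inf m_crit ≥ −1` -/

/-- **The branch clause at one tuple bounds `m_crit` from below by every `c < −1`, eventually.**  If `IsQCDAlong` holds
along `reg.scheme m z shift` (so `−1 < m_crit(k) + a_k m_f / Z_m(k)` eventually for the flavour `f`) and `reg` has mass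
scaling (`a_k m_f / Z_m(k) → 0`, `tendsto_massIncrement_zero`, `N_f ≤ 16`), then `c < m_crit(k)` eventually for every
`c < −1`. [folklore] -/
theorem eventually_lt_mcrit_of_isQCDAlong (hNf : Nf ≤ 16) (reg : QCDRegularisation Nf) (hMS : reg.HasMassScaling)
    {m : Fin Nf → ℝ} {z shift : QCDField Nf → ℕ → ℝ} {T : OSData (QCDField Nf) 4}
    (hQ : IsQCDAlong (reg.scheme m z shift) T) (f : Fin Nf) {c : ℝ} (hc : c < -1) :
    ∀ᶠ k in atTop, c < reg.mcrit k := by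
  obtain ⟨-, hbr, -⟩ := hQ
  have h0 := tendsto_massIncrement_zero hNf reg hMS (m f)
  have hpos : (0 : ℝ) < -1 - c := by linarith
  filter_upwards [hbr f, (tendsto_order.mp h0).2 (-1 - c) hpos] with k hk hk'
  rw [QCDRegularisation.scheme_mq] at hk
  linarith

/-! ## §2 A subsequence INTO the wall -/

/-- **From `lim inf u = −1` to a subsequence converging to `−1`.**  If `u` dips frequently below every `c > −1` and stays
eventually above every `c < −1`, some strictly increasing `φ` has `u ∘ φ → −1`. [folklore] -/
theorem exists_strictMono_tendsto_wall (u : ℕ → ℝ) (hup : ∀ c : ℝ, -1 < c → ∃ᶠ k in atTop, u k < c)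
    (hlow : ∀ c : ℝ, c < -1 → ∀ᶠ k in atTop, c < u k) :
    ∃ φ : ℕ → ℕ, StrictMono φ ∧ Tendsto (u ∘ φ) atTop (𝓝 (-1)) := by
  have hfreq : ∀ n : ℕ, ∃ᶠ k in atTop, |u k + 1| < 1 / ((n : ℝ) + 1) := by
    intro n
    have hn : (0 : ℝ) < 1 / ((n : ℝ) + 1) := by positivity
    have h1 := hup (-1 + 1 / ((n : ℝ) + 1)) (by linarith)
    have h2 := hlow (-1 - 1 / ((n : ℝ) + 1)) (by linarith)
    exact (h1.and_eventually h2).mono fun k hk => abs_lt.mpr ⟨by linarith [hk.2], by linarith [hk.1]⟩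
  obtain ⟨φ, hφ, hφP⟩ := extraction_forall_of_frequently hfreq
  refine ⟨φ, hφ, Metric.tendsto_atTop.2 fun ε hε => ?_⟩
  obtain ⟨N, hN⟩ := exists_nat_one_div_lt hε
  refine ⟨N, fun n hn => ?_⟩
  rw [Real.dist_eq, Function.comp_apply, sub_neg_eq_add]
  have hmono : 1 / ((n : ℝ) + 1) ≤ 1 / ((N : ℝ) + 1) := by
    apply one_div_le_one_div_of_le
    · positivity
    · exact_mod_cast Nat.succ_le_succ hn
  exact lt_of_lt_of_le (hφP n) (hmono.trans hN.le)

/-! ## §3 The body is hereditary to subsequences -/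

/-- `HasMassScaling` (which reads only `a, Z_m`) passes to every subsequence. [folklore] -/
theorem hasMassScaling_restrict (reg : QCDRegularisation Nf) (φ : ℕ → ℕ) (hφ : StrictMono φ)
    (h : reg.HasMassScaling) : (reg.restrict φ hφ.tendsto_atTop).HasMassScaling := by
  obtain ⟨c, hc, ht⟩ := h
  exact ⟨c, hc, ht.comp hφ.tendsto_atTop⟩

/-- **`IsQCDAlong` is hereditary to subsequences** (species renormalisations reindexed with `φ`; the OS data unchanged):
asymptotic scaling and the branch clause are `Tendsto`/`∀ᶠ` statements composed with `φ → ∞`, and the lattice `n`-point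
function of the reindexed scheme at step `k` IS the original one at step `φ k` (it reads only the step data). [folklore] -/
theorem isQCDAlong_restrict (reg : QCDRegularisation Nf) (φ : ℕ → ℕ) (hφ : StrictMono φ) (m : Fin Nf → ℝ)
    (z shift : QCDField Nf → ℕ → ℝ) {T : OSData (QCDField Nf) 4} (hQ : IsQCDAlong (reg.scheme m z shift) T) :
    IsQCDAlong ((reg.restrict φ hφ.tendsto_atTop).scheme m (fun s k => z s (φ k)) (fun s k => shift s (φ k))) T := by
  obtain ⟨⟨Λ, hΛ, hAS⟩, hbr, hconv⟩ := hQ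
  refine ⟨⟨Λ, hΛ, hAS.comp hφ.tendsto_atTop⟩, fun fl => hφ.tendsto_atTop.eventually (hbr fl),
    fun n hn σ f F hF hoff => ?_⟩
  exact (hconv n hn σ f F hF hoff).comp hφ.tendsto_atTop

/-- **The body above an offset is hereditary to subsequences.** [folklore] -/
theorem bodyAbove_restrict (reg : QCDRegularisation Nf) (φ : ℕ → ℕ) (hφ : StrictMono φ) (μ : ℝ)
    (h : ∀ m : Fin Nf → ℝ, (∀ f, μ < m f) →
      ∃ (z shift : QCDField Nf → ℕ → ℝ) (T : OSData (QCDField Nf) 4),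
        IsQCDAlong (reg.scheme m z shift) T ∧ T.IsNontrivial QCDField.glue ∧ T.IsNonGaussian QCDField.glue ∧
          (∀ f g : Fin Nf, f ≠ g → T.IsNontrivial (QCDField.pseudoRe f g)) ∧
            ∃ Δ > 0, T.HasMassGap Δ ∧ (reg.scheme m z shift).HasLatticeMassGap Δ) :
    ∀ m : Fin Nf → ℝ, (∀ f, μ < m f) →
      ∃ (z shift : QCDField Nf → ℕ → ℝ) (T : OSData (QCDField Nf) 4),
        IsQCDAlong ((reg.restrict φ hφ.tendsto_atTop).scheme m z shift) T ∧ T.IsNontrivial QCDField.glue ∧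
          T.IsNonGaussian QCDField.glue ∧ (∀ f g : Fin Nf, f ≠ g → T.IsNontrivial (QCDField.pseudoRe f g)) ∧
            ∃ Δ > 0, T.HasMassGap Δ ∧ ((reg.restrict φ hφ.tendsto_atTop).scheme m z shift).HasLatticeMassGap Δ := by
  intro m hm
  obtain ⟨z, sh, T, hQ, hN, hG, hP, Δ, hΔ, hT, hL⟩ := h m hm
  exact ⟨fun s k => z s (φ k), fun s k => sh s (φ k), T, isQCDAlong_restrict reg φ hφ m z sh hQ, hN, hG, hP, Δ, hΔ,
    hT, Summit.QuantumFields.QCD.Theorems.ChiralDescent.Negative.hasLatticeMassGap_of_eventually_comp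
      hφ.tendsto_atTop (Eventually.of_forall fun _ => ⟨rfl, rfl, rfl, fun _ => rfl⟩) hL⟩

/-! ## §4 W ⇔ W_lim -/

/-- **THE WALL NO-GO IS EQUIVALENT TO ITS FULL-SEQUENCE FORM.**  For every admissible flavour guard (here: any predicate
`adm` on `N_f` implying `0 < N_f ≤ 16`, e.g. `N_f = 2 ∨ N_f = 3`): "every mass-scaling regularisation with
`lim inf m_crit ≤ −1` carries the body above NO offset" (the registered `stub_wallNoGo`, W) holds iff "every mass-scaling
regularisation with `m_crit(k) → −1` carries the body above no offset" (`W_lim`).  (⇐) the body at one tuple pins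
`lim inf m_crit ≥ −1` (§1), so `m_crit ∘ φ → −1` along a subsequence (§2), along which the body is inherited (§3) and
mass scaling too; (⇒) `m_crit → −1` dips below every `c > −1` eventually, hence frequently. [folklore] -/
theorem wallNoGo_iff_wallLimitNoGo (adm : ℕ → Prop) (hadm : ∀ Nf, adm Nf → 0 < Nf ∧ Nf ≤ 16) :
    (∀ Nf : ℕ, adm Nf → ∀ reg : QCDRegularisation Nf, reg.HasMassScaling →
      (∀ c : ℝ, -1 < c → ∃ᶠ k in atTop, reg.mcrit k < c) → ∀ μ : ℝ,
      ¬ ∀ m : Fin Nf → ℝ, (∀ f, μ < m f) →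
        ∃ (z shift : QCDField Nf → ℕ → ℝ) (T : OSData (QCDField Nf) 4),
          IsQCDAlong (reg.scheme m z shift) T ∧ T.IsNontrivial QCDField.glue ∧ T.IsNonGaussian QCDField.glue ∧
            (∀ f g : Fin Nf, f ≠ g → T.IsNontrivial (QCDField.pseudoRe f g)) ∧
              ∃ Δ > 0, T.HasMassGap Δ ∧ (reg.scheme m z shift).HasLatticeMassGap Δ) ↔
    (∀ Nf : ℕ, adm Nf → ∀ reg : QCDRegularisation Nf, reg.HasMassScaling →
      Tendsto reg.mcrit atTop (𝓝 (-1)) → ∀ μ : ℝ,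
      ¬ ∀ m : Fin Nf → ℝ, (∀ f, μ < m f) →
        ∃ (z shift : QCDField Nf → ℕ → ℝ) (T : OSData (QCDField Nf) 4),
          IsQCDAlong (reg.scheme m z shift) T ∧ T.IsNontrivial QCDField.glue ∧ T.IsNonGaussian QCDField.glue ∧
            (∀ f g : Fin Nf, f ≠ g → T.IsNontrivial (QCDField.pseudoRe f g)) ∧
              ∃ Δ > 0, T.HasMassGap Δ ∧ (reg.scheme m z shift).HasLatticeMassGap Δ) := by
  constructor
  · intro hW Nf hNf reg hMS hlim μ
    refine hW Nf hNf reg hMS (fun c hc => ?_) μ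
    exact ((tendsto_order.mp hlim).2 c hc).frequently
  · intro hWlim Nf hNf reg hMS hwall μ hbody
    obtain ⟨hNf0, hNf16⟩ := hadm Nf hNf
    obtain ⟨z, sh, T, hQ, -⟩ := hbody (fun _ => μ + 1) (fun _ => by linarith)
    have hlow : ∀ c : ℝ, c < -1 → ∀ᶠ k in atTop, c < reg.mcrit k := fun c hc =>
      eventually_lt_mcrit_of_isQCDAlong hNf16 reg hMS hQ ⟨0, hNf0⟩ hc
    obtain ⟨φ, hφ, hφt⟩ := exists_strictMono_tendsto_wall reg.mcrit hwall hlow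
    exact hWlim Nf hNf (reg.restrict φ hφ.tendsto_atTop) (hasMassScaling_restrict reg φ hφ hMS) hφt μ
      (bodyAbove_restrict reg φ hφ μ hbody)

/-- `N_f ∈ {2,3}` is an admissible guard: `0 < N_f ≤ 16`. [folklore] -/
theorem guard_two_three (Nf : ℕ) (h : Nf = 2 ∨ Nf = 3) : 0 < Nf ∧ Nf ≤ 16 := by
  rcases h with rfl | rfl <;> norm_num

/-- **W from W_lim, in the registered form** (guard `N_f = 2 ∨ N_f = 3`; registered sub-goal `wallNoGo_of_wallLimitNoGo` of
stmt-QuantumFields-17527): the reduction a lead uses to replace the `sorry` of `stub_wallNoGo` by the full-sequence wall statement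
`stub_wallLimitNoGo`. [folklore] -/
theorem wallNoGo_of_wallLimitNoGo : (∀ Nf : ℕ, (Nf = 2 ∨ Nf = 3) → ∀ reg : QCDRegularisation Nf, reg.HasMassScaling → Tendsto reg.mcrit atTop (nhds (-1)) → ∀ μ : ℝ, ¬ ∀ m : Fin Nf → ℝ, (∀ f, μ < m f) → ∃ (z shift : QCDField Nf → ℕ → ℝ) (T : OSData (QCDField Nf) 4), IsQCDAlong (reg.scheme m z shift) T ∧ T.IsNontrivial QCDField.glue ∧ T.IsNonGaussian QCDField.glue ∧ (∀ f g : Fin Nf, f ≠ g → T.IsNontrivial (QCDField.pseudoRe f g)) ∧ ∃ Δ > 0, T.HasMassGap Δ ∧ (reg.scheme m z shift).HasLatticeMassGap Δ) → ∀ Nf : ℕ, (Nf = 2 ∨ Nf = 3) → ∀ reg : QCDRegularisation Nf, reg.HasMassScaling → (∀ c : ℝ, -1 < c → ∃ᶠ k in atTop, reg.mcrit k < c) → ∀ μ : ℝ, ¬ ∀ m : Fin Nf → ℝ, (∀ f, μ < m f) → ∃ (z shift : QCDField Nf → ℕ → ℝ) (T : OSData (QCDField Nf) 4), IsQCDAlong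 (reg.scheme m z shift) T ∧ T.IsNontrivial QCDField.glue ∧ T.IsNonGaussian QCDField.glue ∧ (∀ f g : Fin Nf, f ≠ g → T.IsNontrivial (QCDField.pseudoRe f g)) ∧ ∃ Δ > 0, T.HasMassGap Δ ∧ (reg.scheme m z shift).HasLatticeMassGap Δ :=
  (wallNoGo_iff_wallLimitNoGo (fun Nf => Nf = 2 ∨ Nf = 3) guard_two_three).mpr

end Summit.QuantumFields.QCD.Cruxes.ChiralDescent.GapUpsetRecut.WallLimit
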